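import Literature.Algebra.Homology.OrderedCechExtendScalars
import Literature.Algebra.Homology.OrderedCechRestrict
import Mathlib.Algebra.Homology.HomologicalComplexAbelian
import Mathlib.Algebra.Homology.ShortComplex.ModuleCat
import Mathlib.Algebra.Category.ModuleCat.ChangeOfRings
import Mathlib.LinearAlgebra.TensorProduct.Pi
import Mathlib.LinearAlgebra.TensorProduct.RightExactness
import Mathlib.RingTheory.Flat.Basic
import Mathlib.CategoryTheory.Category.Preorder
import HarnessLib

/-!
# The ordered Čech complex of a SYSTEM of modules (restriction maps instead of inclusions)
# (Görtz–Wedhorn II, Def. 21.68; The Stacks Project, Tag 01FG)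

`Literature/Algebra/Homology/OrderedCech` builds the ordered Čech complex of a monotone family of
SUBmodules `F s ⊆ 𝕂` of one ambient module — the shape of the sections `Γ(W_s, 𝓕) ⊆ K(X)` of a
subsheaf of a constant sheaf on an INTEGRAL scheme. For a quasi-coherent module `𝓛` on a scheme which
is not integral (e.g. `P ×_K Spec A` with `A` non-reduced, the test schemes of the scheme-theoretic
seesaw theorem, Görtz–Wedhorn II, Thm. 24.66 / Mumford, *Abelian Varieties*, §10) the restriction maps
`Γ(W_s, 𝓛) → Γ(W_t, 𝓛)` (`s ⊆ t`) are no longer injective, and the Čech complex must be built from a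
**system** of modules: a functor `M : Finset ι ⥤ ModuleCat A` on the poset of finite subsets of the
(finite, linearly ordered) index set, `s ↦ Γ(W_s, 𝓛)`, `(s ⊆ t) ↦ res`. This file builds that complex,
with the SAME simplices, signs and formula as `OrderedCech.complex`
(Görtz–Wedhorn II, Def. 21.68: `(d g)_{i₀…i_{n+1}} = Σ_j (-1)^j g_{i₀…î_j…i_{n+1}}|_{U_{i₀…i_{n+1}}}`):

* `OrderedCech.SysCochain M n = Π_{σ : Simplex ι n} M σ` (a type synonym of the product, with its
  `AddCommGroup`/`Module A` structure), the zero-extension `SysCochain.ext0At` of a component to an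
  arbitrary finite subset, `OrderedCech.sysFaceMap`, and the differential `OrderedCech.sysD M n` with
  `(d g)_σ = Σ_{a ∈ σ} sign σ a • M.map (σ ∖ a ⊆ σ) g_{σ ∖ a}` (`sysD_apply`), `sysD_sysD` (`d ∘ d = 0`);
* **`OrderedCech.sysComplex M : CochainComplex (ModuleCat A) ℤ`**, concentrated in degrees
  `[0, #ι - 1]` (`isStrictlyGE_sysComplex`, `isStrictlyLE_sysComplex(_of_card_le)`), with flat terms
  when the `M s` (`s ≠ ∅`) are flat (`flat_sysCochain`, `flat_sysComplex_X`).

Functoriality in the system, `Ȟ⁰`, the comparison with the submodule model, tensoring with a module and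
base change live in the sequel files `OrderedCechSystemMap`, `OrderedCechSystemLTensor`,
`OrderedCechSystemBaseChange`. Everything is elementary and proved; no named facts; no geometry.
Mathlib searched (pin): `CategoryTheory/Sites/SheafCohomology/Cech` (full Čech complex of a presheaf,
unbounded; no ordered/alternating complex of a system of modules), `CochainComplex.of`,
`DirectSum.linearEquivFunOnFintype`, `Module.Flat.of_linearEquiv` (used).

## References

* U. Görtz, T. Wedhorn, *Algebraic Geometry II: Cohomology of Schemes*, Springer Spektrum (2023),
  doi:10.1007/978-3-658-43031-3: Def. 21.64, Lemma 21.65, Def. 21.68, Cor. 21.70 (pp. 179–181). [GortzWedhorn2023]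
* The Stacks Project, Tag 01FG (the alternating/ordered Čech complex). [StacksProject]
-/

universe v u

open CategoryTheory TensorProduct

set_option backward.isDefEq.respectTransparency false

noncomputable section

namespace Literature.Algebra.Homology

namespace OrderedCech

variable {ι : Type} [LinearOrder ι] {A : Type u} [CommRing A]

/-! ### Cochains of a system and the differential -/

section System

variable (M : Finset ι ⥤ ModuleCat.{v} A)

/-- The `n`-cochains `Π_{#s = n+1} M s` of a system of modules `M` on the finite subsets of `ι`
(ordered Čech cochains, Görtz–Wedhorn II, Def. 21.68). [cite: GortzWedhorn2023, Def. 21.68 (p. 180)] -/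
def SysCochain (n : ℤ) : Type v := ∀ σ : Simplex ι n, M.obj σ.1

/-- Cochains form an abelian group (pointwise). [folklore] [cite: GortzWedhorn2023, Def. 21.68 (p. 180)] -/
instance (n : ℤ) : AddCommGroup (SysCochain M n) :=
  inferInstanceAs (AddCommGroup (∀ σ : Simplex ι n, M.obj σ.1))

/-- Cochains form an `A`-module (pointwise). [folklore] [cite: GortzWedhorn2023, Def. 21.68 (p. 180)] -/
instance (n : ℤ) : Module A (SysCochain M n) :=
  inferInstanceAs (Module A (∀ σ : Simplex ι n, M.obj σ.1))

/-- In degrees without simplices there is only the zero cochain. [folklore] [cite: GortzWedhorn2023, Def. 21.68 (p. 180)] -/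
instance (n : ℤ) [IsEmpty (Simplex ι n)] : Unique (SysCochain M n) :=
  inferInstanceAs (Unique (∀ σ : Simplex ι n, M.obj σ.1))

variable {M} in
/-- The value of a cochain at `s`, pushed forward to `M t` along `s ⊆ t`, extended by zero when `s` is
not an `n`-simplex or `s ⊄ t`. The membership `s ⊆ t` is part of the condition, so that the expression
has no proof argument and can be rewritten along equalities of finite sets. [folklore] [cite: GortzWedhorn2023, Def. 21.68 (p. 180)] -/
def SysCochain.ext0At {n : ℤ} (g : SysCochain M n) (s t : Finset ι) : M.obj t :=
  if h : (s.Nonempty ∧ (s.card : ℤ) = n + 1) ∧ s ⊆ t then (M.map (homOfLE h.2)).hom (g ⟨s, h.1⟩) else 0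

variable {M} in
/-- On an `n`-simplex `σ ⊆ t` the extension is `M.map (σ ⊆ t) g_σ`. [folklore] [cite: GortzWedhorn2023, Def. 21.68 (p. 180)] -/
theorem SysCochain.ext0At_val {n : ℤ} (g : SysCochain M n) (σ : Simplex ι n) (t : Finset ι)
    (h : σ.1 ⊆ t) : g.ext0At σ.1 t = (M.map (homOfLE h)).hom (g σ) := by
  unfold SysCochain.ext0At
  rw [dif_pos ⟨σ.2, h⟩]
  rfl

variable {M} in
/-- `ext0At` at `t = s` on a simplex is the value itself. [folklore] [cite: GortzWedhorn2023, Def. 21.68 (p. 180)] -/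
theorem SysCochain.ext0At_self {n : ℤ} (g : SysCochain M n) (σ : Simplex ι n) :
    g.ext0At σ.1 σ.1 = g σ := by
  rw [SysCochain.ext0At_val g σ σ.1 subset_rfl]
  have : (homOfLE (subset_rfl : σ.1 ⊆ σ.1)) = 𝟙 σ.1 := rfl
  rw [this, M.map_id]
  rfl

variable {M} in
/-- `ext0At` is additive. [folklore] [cite: GortzWedhorn2023, Def. 21.68 (p. 180)] -/
theorem SysCochain.ext0At_add {n : ℤ} (g g' : SysCochain M n) (s t : Finset ι) :
    (g + g').ext0At s t = g.ext0At s t + g'.ext0At s t := by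
  unfold SysCochain.ext0At
  split_ifs with h
  · exact map_add _ _ _
  · rw [add_zero]

variable {M} in
/-- `ext0At` is `A`-homogeneous. [folklore] [cite: GortzWedhorn2023, Def. 21.68 (p. 180)] -/
theorem SysCochain.ext0At_smul {n : ℤ} (c : A) (g : SysCochain M n) (s t : Finset ι) :
    (c • g).ext0At s t = c • g.ext0At s t := by
  unfold SysCochain.ext0At
  split_ifs with h
  · exact map_smul _ _ _
  · rw [smul_zero]

variable {M} in
/-- Transitivity: pushing `g.ext0At s t` further to `t' ⊇ t` gives `g.ext0At s t'`. [folklore] [cite: GortzWedhorn2023, Def. 21.68 (p. 180)] -/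
theorem SysCochain.map_ext0At {n : ℤ} (g : SysCochain M n) (s t t' : Finset ι) (hst : s ⊆ t)
    (htt' : t ⊆ t') : (M.map (homOfLE htt')).hom (g.ext0At s t) = g.ext0At s t' := by
  unfold SysCochain.ext0At
  by_cases hs : s.Nonempty ∧ (s.card : ℤ) = n + 1
  · rw [dif_pos ⟨hs, hst⟩, dif_pos ⟨hs, hst.trans htt'⟩, ← ModuleCat.comp_apply, ← M.map_comp]
    rfl
  · rw [dif_neg (fun h => hs h.1), dif_neg (fun h => hs h.1), map_zero]

/-- A face of a simplex with its sign, as a linear map `Čⁿ → M σ`: `g ↦ ε(σ, a) • res g_{σ ∖ a}` (zero if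
`σ ∖ a` is not an `n`-simplex). [folklore] [cite: GortzWedhorn2023, Def. 21.68 (p. 180)] -/
def sysFaceMap (n : ℤ) (σ : Simplex ι (n + 1)) (a : ι) : SysCochain M n →ₗ[A] M.obj σ.1 :=
  if h : (σ.1.erase a).Nonempty ∧ ((σ.1.erase a).card : ℤ) = n + 1 then
    sign A σ.1 a • ((M.map (homOfLE (Finset.erase_subset a σ.1))).hom ∘ₗ
      LinearMap.proj (R := A) (φ := fun τ : Simplex ι n => (M.obj τ.1 : Type v)) ⟨σ.1.erase a, h⟩)
  else 0

/-- The value of `sysFaceMap`: `ε(σ, a) • g.ext0At (σ ∖ a) σ`. [folklore] [cite: GortzWedhorn2023, Def. 21.68 (p. 180)] -/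
theorem sysFaceMap_apply (n : ℤ) (σ : Simplex ι (n + 1)) (a : ι) (g : SysCochain M n) :
    sysFaceMap M n σ a g = sign A σ.1 a • g.ext0At (σ.1.erase a) σ.1 := by
  unfold sysFaceMap SysCochain.ext0At
  by_cases h : (σ.1.erase a).Nonempty ∧ ((σ.1.erase a).card : ℤ) = n + 1
  · rw [dif_pos h, dif_pos ⟨h, Finset.erase_subset a σ.1⟩]
    rfl
  · rw [dif_neg h, dif_neg (fun h' => h h'.1), smul_zero, LinearMap.zero_apply]

/-- **The ordered Čech differential of a system** `d : Čⁿ → Čⁿ⁺¹`,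
`(d g)_σ = Σ_{a ∈ σ} (-1)^{#{b ∈ σ ; b < a}} M.map (σ ∖ a ⊆ σ) g_{σ ∖ a}` (Görtz–Wedhorn II, Def. 21.68
with Def. 21.64). [cite: GortzWedhorn2023, Def. 21.68 with Def. 21.64 (pp. 179–181)] -/
def sysD (n : ℤ) : SysCochain M n →ₗ[A] SysCochain M (n + 1) :=
  LinearMap.pi fun σ => ∑ a ∈ σ.1, sysFaceMap M n σ a

/-- The differential: `(d g)_σ = Σ_{a ∈ σ} ε(σ, a) • g.ext0At (σ ∖ a) σ`. [folklore] [cite: GortzWedhorn2023, Def. 21.68 (p. 180)] -/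
theorem sysD_apply (n : ℤ) (g : SysCochain M n) (σ : Simplex ι (n + 1)) :
    sysD M n g σ = ∑ a ∈ σ.1, sign A σ.1 a • g.ext0At (σ.1.erase a) σ.1 := by
  change (∑ a ∈ σ.1, sysFaceMap M n σ a) g = _
  rw [LinearMap.sum_apply]
  exact Finset.sum_congr rfl fun a _ => sysFaceMap_apply M n σ a g

/-- `(d g).ext0At s t = Σ_{a ∈ s} ε(s, a) • g.ext0At (s ∖ a) t` for `s ⊆ t` with `#s ≥ 2`. [folklore] [cite: GortzWedhorn2023, Def. 21.68 (p. 180)] -/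
theorem ext0At_sysD (n : ℤ) (g : SysCochain M n) (s t : Finset ι) (hst : s ⊆ t) (hs : 2 ≤ s.card) :
    (sysD M n g).ext0At s t = ∑ a ∈ s, sign A s a • g.ext0At (s.erase a) t := by
  by_cases h : s.Nonempty ∧ (s.card : ℤ) = n + 1 + 1
  · rw [SysCochain.ext0At_val (sysD M n g) ⟨s, h⟩ t hst, sysD_apply, map_sum]
    refine Finset.sum_congr rfl fun a _ => ?_
    rw [map_smul, SysCochain.map_ext0At g _ _ _ (Finset.erase_subset a s) hst]
  · unfold SysCochain.ext0At
    rw [dif_neg (fun h' => h h'.1)]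
    symm
    refine Finset.sum_eq_zero fun a ha => ?_
    rw [dif_neg, smul_zero]
    rintro ⟨⟨-, hcard⟩, -⟩
    apply h
    refine ⟨⟨a, ha⟩, ?_⟩
    have := Finset.card_erase_of_mem ha
    omega

/-- In negative degrees the differential vanishes. [folklore] [cite: GortzWedhorn2023, Def. 21.68 (p. 180)] -/
theorem sysD_eq_zero_of_neg (n : ℤ) (hn : n < 0) : sysD M n = 0 := by
  haveI : IsEmpty (Simplex ι n) := isEmpty_simplex_of_neg hn
  apply LinearMap.ext
  intro g
  rw [Subsingleton.elim g 0, map_zero, LinearMap.zero_apply]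

/-- **`d ∘ d = 0`** for the ordered Čech differential of a system: the terms for `(a, b)` and `(b, a)`
cancel (`sign_mul_sign_erase_add`). [cite: GortzWedhorn2023, Def. 21.64 and Def. 21.68 (pp. 179–181)] -/
theorem sysD_sysD (n : ℤ) (g : SysCochain M n) : sysD M (n + 1) (sysD M n g) = 0 := by
  rcases lt_or_ge n 0 with hn | hn
  · rw [sysD_eq_zero_of_neg M n hn, LinearMap.zero_apply, map_zero]
  funext τ
  rw [sysD_apply]
  change ∑ a ∈ τ.1, sign A τ.1 a • (sysD M n g).ext0At (τ.1.erase a) τ.1 = 0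
  have hτ : (τ.1.card : ℤ) = n + 1 + 1 + 1 := τ.2.2
  have inner : ∀ a ∈ τ.1, (sysD M n g).ext0At (τ.1.erase a) τ.1 =
      ∑ b ∈ τ.1.erase a, sign A (τ.1.erase a) b • g.ext0At ((τ.1.erase a).erase b) τ.1 :=
    fun a ha => ext0At_sysD M n g _ _ (Finset.erase_subset a τ.1)
      (by have := Finset.card_erase_of_mem ha; omega)
  rw [Finset.sum_congr rfl fun a ha => by rw [inner a ha, Finset.smul_sum]]
  simp_rw [smul_smul]
  rw [Finset.sum_sigma' τ.1 fun a => τ.1.erase a]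
  refine Finset.sum_involution (fun x _ => ⟨x.2, x.1⟩) ?_ ?_ ?_ ?_
  · rintro ⟨a, b⟩ hx
    obtain ⟨ha, hb⟩ := Finset.mem_sigma.1 hx
    obtain ⟨hba, hb'⟩ := Finset.mem_erase.1 hb
    dsimp only
    rw [Finset.erase_right_comm (a := b) (b := a), ← add_smul,
      sign_mul_sign_erase_add ha hb' (Ne.symm hba), zero_smul]
  · rintro ⟨a, b⟩ hx -
    obtain ⟨-, hb⟩ := Finset.mem_sigma.1 hx
    have hba : b ≠ a := (Finset.mem_erase.1 hb).1
    intro h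
    exact hba (congr_arg Sigma.fst h)
  · rintro ⟨a, b⟩ hx
    obtain ⟨ha, hb⟩ := Finset.mem_sigma.1 hx
    obtain ⟨hba, hb'⟩ := Finset.mem_erase.1 hb
    exact Finset.mem_sigma.2 ⟨hb', Finset.mem_erase.2 ⟨Ne.symm hba, ha⟩⟩
  · rintro ⟨a, b⟩ hx
    rfl

/-! ### The complex of a system -/

/-- **The ordered Čech complex of a system of modules** as a cochain complex of `A`-modules indexed by
`ℤ`. [cite: GortzWedhorn2023, Def. 21.68 (p. 180)] -/
def sysComplex : CochainComplex (ModuleCat.{v} A) ℤ :=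
  CochainComplex.of (fun n => ModuleCat.of A (SysCochain M n)) (fun n => ModuleCat.ofHom (sysD M n))
    fun n => by
      ext g
      simp [sysD_sysD]

/-- The terms of the complex are the cochain modules. [folklore] [cite: GortzWedhorn2023, Def. 21.68 (p. 180)] -/
@[simp] theorem sysComplex_X (n : ℤ) : (sysComplex M).X n = ModuleCat.of A (SysCochain M n) := rfl

/-- The differentials of the complex are the ordered Čech differentials. [folklore] [cite: GortzWedhorn2023, Def. 21.68 (p. 180)] -/
@[simp] theorem sysComplex_d (n : ℤ) : (sysComplex M).d n (n + 1) = ModuleCat.ofHom (sysD M n) := by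
  change CochainComplex.of.d (V := ModuleCat.{v} A) (fun n => ModuleCat.of A (SysCochain M n))
    (fun n => ModuleCat.ofHom (sysD M n)) n (n + 1) = _
  exact CochainComplex.of_d _ _ n

/-- The complex vanishes in negative degrees. [folklore] [cite: GortzWedhorn2023, Def. 21.68 (p. 180)] -/
theorem isZero_sysComplex_X_of_neg (n : ℤ) (hn : n < 0) : Limits.IsZero ((sysComplex M).X n) := by
  haveI : IsEmpty (Simplex ι n) := isEmpty_simplex_of_neg hn
  change Limits.IsZero (ModuleCat.of A (SysCochain M n))
  exact ModuleCat.isZero_of_subsingleton _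

/-- The complex vanishes in degrees `≥ #ι`. [cite: GortzWedhorn2023, Cor. 21.70 (p. 181)] -/
theorem isZero_sysComplex_X_of_card_le [Fintype ι] (n : ℤ) (hn : (Fintype.card ι : ℤ) ≤ n) :
    Limits.IsZero ((sysComplex M).X n) := by
  haveI : IsEmpty (Simplex ι n) := isEmpty_simplex_of_card_le hn
  change Limits.IsZero (ModuleCat.of A (SysCochain M n))
  exact ModuleCat.isZero_of_subsingleton _

/-- The complex is concentrated in degrees `≥ 0`. [folklore] [cite: GortzWedhorn2023, Def. 21.68 (p. 180)] -/
theorem isStrictlyGE_sysComplex : (sysComplex M).IsStrictlyGE 0 := by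
  rw [CochainComplex.isStrictlyGE_iff]
  intro i hi
  exact isZero_sysComplex_X_of_neg M i hi

/-- The complex is concentrated in degrees `≤ #ι - 1`. [folklore] [cite: GortzWedhorn2023, Def. 21.68 (p. 180)] -/
theorem isStrictlyLE_sysComplex [Fintype ι] : (sysComplex M).IsStrictlyLE (Fintype.card ι - 1) := by
  rw [CochainComplex.isStrictlyLE_iff]
  intro i hi
  exact isZero_sysComplex_X_of_card_le M i (by omega)

/-- The complex is concentrated in degrees `≤ r` as soon as `#ι ≤ r + 1`. [folklore] [cite: GortzWedhorn2023, Def. 21.68 (p. 180)] -/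
theorem isStrictlyLE_sysComplex_of_card_le [Fintype ι] (r : ℤ) (hr : (Fintype.card ι : ℤ) ≤ r + 1) :
    (sysComplex M).IsStrictlyLE r := by
  rw [CochainComplex.isStrictlyLE_iff]
  intro i hi
  exact isZero_sysComplex_X_of_card_le M i (by omega)

/-- **The terms of the ordered Čech complex of a system are flat** as soon as the `M s` (`s ≠ ∅`) are.
[folklore] [cite: GortzWedhorn2023, Def. 21.68 (p. 180)] -/
theorem flat_sysCochain [Fintype ι] (hflat : ∀ s : Finset ι, s.Nonempty → Module.Flat A (M.obj s))
    (n : ℤ) : Module.Flat A (SysCochain M n) := by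
  classical
  haveI : ∀ σ : Simplex ι n, Module.Flat A (M.obj σ.1) := fun σ => hflat σ.1 σ.2.1
  exact Module.Flat.of_linearEquiv
    (DirectSum.linearEquivFunOnFintype A (Simplex ι n) fun σ => (M.obj σ.1 : Type v)).symm

/-- Flatness of the terms, stated on the complex. [folklore] [cite: GortzWedhorn2023, Def. 21.68 (p. 180)] -/
theorem flat_sysComplex_X [Fintype ι] (hflat : ∀ s : Finset ι, s.Nonempty → Module.Flat A (M.obj s))
    (n : ℤ) : Module.Flat A ((sysComplex M).X n) :=
  flat_sysCochain M hflat n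

end System

end OrderedCech

end Literature.Algebra.Homology

end
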